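import Summits.QuantumFields.YangMills.Theorems.F4SubCurvatureDoorTwoMirrorFibres
import Mathlib
import HarnessLib

/-!
# Two non-perpendicular RP mirrors: the geometric core (no mass at positive energy)

Helper (definition-free) for the by-name rung `TwoMirrorLFConstancy` / `HexagonalLFConstancy` of LINE g19-A «transverse
slice» on crux ⟨stmt-QuantumFields-23035⟩ (rung file `Cruxes/ShortRootRigidity/Lines/transverse_slice_rung_bounded.lean`).

SETTING.  `μ` is a finite measure on `(E, p) ∈ ℝ × ℝ` carried by `E ≥ 0`; `ν` is a finite planar measure with the FRAME
FORMULA `ν(A) = ∫ [C{ξ : (Eξ, p) ∈ A} + C{ξ : (Eξ, -p) ∈ A}] dμ` (`C` = standard Cauchy law; so `ν` is «Cauchy of scale `E`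
along every horizontal fibre») which is moreover invariant under the rotation `q ↦ (cq₀ + sq₁, -sq₀ + cq₁)` with `c, s > 0`,
`c² + s² = 1` (so `ν` is ALSO fibrewise Cauchy along the rotated fibres).  CLAIM (`measure_box_eq_zero`,
`measure_pos_energy_eq_zero`): `μ{E > 0} = 0`.

PROOF (two applications of the scale-free monotonicity `cauchy_preimage_mul_Icc_ratio` of the Cauchy kernel).  If the box
`{1/N ≤ E ≤ N, |p| ≤ N}` had mass `m > 0`, then for every large `ρ`: (A) the Cauchy tails give the far frame box
`O = [ρ, ρ+1] × [-N, N]` mass `≥ m/(πN(N² + (ρ+1)²))`; `O` lies in the rotated box `W_out × S`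
(`W_out = [cρ - N, cρ + N + 1]` along the rotated fibre, `S = [-sρ - N - 1, -sρ + N]` across), so (B) monotonicity along the
ROTATED fibres moves this mass inward to `W_mid × S`, `W_mid = [cρ/4, cρ/2]`, gaining the factor `(cρ/4)/(2N+1)`; every point of
`P = rot⁻¹(W_mid × S)` has `q₀ ≥ s²ρ/2` and `q₁ ≤ -scρ/2 + N`, and each HORIZONTAL fibre meets `P` in an interval of length
`≤ (2N+1)/s`, so (C) monotonicity along the horizontal fibres moves the mass inward to `V = [-s²ρ/2, s²ρ/2] × T`, gaining the
factor `s³ρ/(2N+1)`.  Altogether `ν(V) ≥ s³c·m/(20πN(2N+1)²)` uniformly in `ρ`, while `V ⊆ {|q₁| ≥ scρ/2 - N}` and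
`ν{|q₁| ≥ n} → 0` — contradiction.  (At `90°` step (B) is void, `c = 0`; at `0°` step (C) is void, `s = 0`: the witness
`e^{-|y₀|} + e^{-|y₁|}` of the rung file is exactly the perpendicular case.)

The one-fibre inequalities, the geometry of `P` and the two containments are in the companion file
`…F4SubCurvatureDoorTwoMirrorFibres`; this file integrates them (`measure_box_eq_zero`) and exhausts `{E > 0}` by boxes
(`measure_pos_energy_eq_zero`).

HONEST LABEL: a rung strictly inside the bounded toy case of the heart `stub_planarRigidity`; nothing about the singular case,
⟨23035⟩, R2d or any summit is proved by this file.
-/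

noncomputable section

open MeasureTheory Set Filter Topology
open scoped ENNReal NNReal

namespace Summit.QuantumFields.YangMills.Theorems.F4SubCurvatureDoorTwoMirrorCore

open Summit.QuantumFields.YangMills.Theorems.F4SubCurvatureDoorCauchyKernel
open Summit.QuantumFields.YangMills.Theorems.F4SubCurvatureDoorTwoMirrorFibres

/-! ## The contradiction -/

/-- **No mass in any energy box.**  Under the frame formula and the rotation invariance of `ν` (with `c, s > 0`,
`c² + s² = 1`), `μ([1/N, N] × [-N, N]) = 0` for every `N ≥ 1`. -/
theorem measure_box_eq_zero (μ : Measure (ℝ × ℝ)) [IsFiniteMeasure μ] (hae : ∀ᵐ z ∂μ, 0 ≤ z.1)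
    {c s : ℝ} (hc : 0 < c) (hs : 0 < s) (hcs : c ^ 2 + s ^ 2 = 1)
    (ν : Measure (ℝ × ℝ)) [IsFiniteMeasure ν]
    (hνF : ∀ A : Set (ℝ × ℝ), MeasurableSet A →
        ν A = (∫⁻ z, (volume.withDensity fun x : ℝ => ENNReal.ofReal (Real.pi⁻¹ * (1 + x ^ 2)⁻¹))
                  {x : ℝ | (z.1 * x, z.2) ∈ A} ∂μ)
            + ∫⁻ z, (volume.withDensity fun x : ℝ => ENNReal.ofReal (Real.pi⁻¹ * (1 + x ^ 2)⁻¹))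
                  {x : ℝ | (z.1 * x, -z.2) ∈ A} ∂μ)
    (hνR : ∀ B : Set (ℝ × ℝ), MeasurableSet B →
        ν {q | (c * q.1 + s * q.2, -s * q.1 + c * q.2) ∈ B} = ν B)
    {N : ℝ} (hN : 1 ≤ N) :
    μ (Icc N⁻¹ N ×ˢ Icc (-N) N) = 0 := by
  set C : Measure ℝ := volume.withDensity fun x : ℝ => ENNReal.ofReal (Real.pi⁻¹ * (1 + x ^ 2)⁻¹) with hC
  haveI : IsProbabilityMeasure C := isProbabilityMeasure_cauchy
  by_contra hbox
  set m := μ (Icc N⁻¹ N ×ˢ Icc (-N) N) with hm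
  have hmpos : 0 < m := pos_iff_ne_zero.2 hbox
  -- the uniform constant
  set η₀ : ℝ := s ^ 3 * c / (20 * Real.pi * N * (2 * N + 1) ^ 2) with hη₀
  have hη₀pos : 0 < η₀ := by rw [hη₀]; positivity
  set η : ℝ≥0∞ := ENNReal.ofReal η₀ * m with hη
  have hηpos : 0 < η := ENNReal.mul_pos (ENNReal.ofReal_pos.2 hη₀pos).ne' hbox
  -- tails of ν
  set A : ℕ → Set (ℝ × ℝ) := fun n => {q | (n : ℝ) ≤ |q.2|} with hA
  have hAmeas : ∀ n, MeasurableSet (A n) := fun n =>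
    measurableSet_le measurable_const (measurable_snd.abs)
  have hAanti : Antitone A := by
    intro i j hij q hq
    simp only [hA, mem_setOf_eq] at hq ⊢
    exact le_trans (by exact_mod_cast hij) hq
  have hAempty : (⋂ n, A n) = ∅ := by
    ext q
    simp only [mem_iInter, hA, mem_setOf_eq, mem_empty_iff_false, iff_false, not_forall, not_le]
    exact exists_nat_gt |q.2|
  have htend : Tendsto (ν ∘ A) atTop (𝓝 0) := by
    have h := tendsto_measure_iInter_atTop (μ := ν) (fun n => (hAmeas n).nullMeasurableSet) hAanti
      ⟨0, measure_ne_top ν _⟩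
    rwa [hAempty, measure_empty] at h
  obtain ⟨n₀, hn₀⟩ : ∃ n₀ : ℕ, ν (A n₀) < η := by
    have h := (tendsto_order.1 htend).2 η hηpos
    rw [eventually_atTop] at h
    obtain ⟨n₀, hn₀⟩ := h
    exact ⟨n₀, hn₀ n₀ le_rfl⟩
  -- choose the scale ρ
  set ρ : ℝ := max (max (2 * N / c) (2 * N / s ^ 2)) (max (2 * (N + n₀) / (s * c)) N) with hρ_def
  have hρN : N ≤ ρ := le_trans (le_max_right _ _) (le_max_right _ _)
  have hρpos : 0 < ρ := by linarith
  have hρ1 : N ≤ c * ρ / 2 := by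
    have h : 2 * N / c ≤ ρ := le_trans (le_max_left _ _) (le_max_left _ _)
    rw [div_le_iff₀ hc] at h
    linarith
  have hρ2 : N ≤ s ^ 2 * ρ / 2 := by
    have h : 2 * N / s ^ 2 ≤ ρ := le_trans (le_max_right _ _) (le_max_left _ _)
    rw [div_le_iff₀ (by positivity)] at h
    linarith
  have hρ3 : N + n₀ ≤ s * c * ρ / 2 := by
    have h : 2 * (N + n₀) / (s * c) ≤ ρ := le_trans (le_max_left _ _) (le_max_right _ _)
    rw [div_le_iff₀ (by positivity)] at h
    linarith
  -- the sets
  set O : Set (ℝ × ℝ) := Icc ρ (ρ + 1) ×ˢ Icc (-N) N with hO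
  set Wout : Set ℝ := Icc (c * ρ - N) (c * ρ + N + 1) with hWout
  set Wmid : Set ℝ := Icc (c * ρ / 4) (c * ρ / 2) with hWmid
  set S : Set ℝ := Icc (-s * ρ - N - 1) (-s * ρ + N) with hS
  set P : Set (ℝ × ℝ) := {q | (c * q.1 + s * q.2, -s * q.1 + c * q.2) ∈ Wmid ×ˢ S} with hP
  set T : Set ℝ := Icc (-(3 / 4) * s * c * ρ - N - 1) (-(s * c * ρ) / 2 + N) with hT
  set V : Set (ℝ × ℝ) := Icc (-(s ^ 2 * ρ / 2)) (s ^ 2 * ρ / 2) ×ˢ T with hV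
  have hrot : Measurable fun q : ℝ × ℝ => (c * q.1 + s * q.2, -s * q.1 + c * q.2) := by fun_prop
  have hOm : MeasurableSet O := measurableSet_Icc.prod measurableSet_Icc
  have hWoutS : MeasurableSet (Wout ×ˢ S) := measurableSet_Icc.prod measurableSet_Icc
  have hWmidS : MeasurableSet (Wmid ×ˢ S) := measurableSet_Icc.prod measurableSet_Icc
  have hPm : MeasurableSet P := hWmidS.preimage hrot
  have hVm : MeasurableSet V := measurableSet_Icc.prod measurableSet_Icc
  -- the three ratios
  set rA : ℝ := Real.pi⁻¹ * (N⁻¹ / (N ^ 2 + (ρ + 1) ^ 2)) with hrA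
  set rB : ℝ := (c * ρ / 2 - c * ρ / 4) / (2 * N + 1) with hrB
  set rC : ℝ := (s ^ 2 * ρ / 2 - -(s ^ 2 * ρ / 2)) / ((2 * N + 1) / s) with hrC
  -- Step (A): the far box
  have hStepA : ENNReal.ofReal rA * m ≤ ν O := by
    rw [hνF O hOm]
    refine le_trans ?_ (le_add_right le_rfl)
    refine le_trans ?_ (setLIntegral_le_lintegral (Icc N⁻¹ N ×ˢ Icc (-N) N) _)
    rw [hm, ← setLIntegral_const]
    refine setLIntegral_mono' (measurableSet_Icc.prod measurableSet_Icc) fun z hz => ?_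
    simp only [mem_prod, mem_Icc] at hz
    obtain ⟨⟨hz1, hz2⟩, hz3, hz4⟩ := hz
    have hzpos : 0 < z.1 := lt_of_lt_of_le (by positivity) hz1
    have e1 : {x : ℝ | (z.1 * x, z.2) ∈ O} = {x : ℝ | z.1 * x ∈ Icc ρ (ρ + 1)} := by
      ext x
      simp only [hO, mem_setOf_eq, mem_prod, mem_Icc]
      constructor
      · exact fun h => h.1
      · exact fun h => ⟨h, hz3, hz4⟩
    rw [e1]
    refine le_trans ?_ (le_cauchy_preimage_mul_Icc_far hzpos hρpos.le)
    apply ENNReal.ofReal_le_ofReal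
    rw [hrA]
    refine mul_le_mul_of_nonneg_left ?_ (by positivity)
    rw [div_le_div_iff₀ (by positivity) (by positivity)]
    have h1 : N⁻¹ * (ρ + 1) ^ 2 ≤ z.1 * (ρ + 1) ^ 2 := mul_le_mul_of_nonneg_right hz1 (by positivity)
    have h2 : N⁻¹ * z.1 ^ 2 ≤ z.1 * N ^ 2 := by
      have hNpos : 0 < N := by linarith
      have : N⁻¹ * z.1 ≤ N ^ 2 := by
        calc N⁻¹ * z.1 ≤ 1 * N := by
              refine mul_le_mul (inv_le_one_of_one_le₀ hN) hz2 hzpos.le zero_le_one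
          _ ≤ N ^ 2 := by nlinarith
      nlinarith
    nlinarith
  -- Step (B): along the rotated fibres
  have hStepB : ENNReal.ofReal rB * ν (Wout ×ˢ S) ≤ ν (Wmid ×ˢ S) := by
    rw [hνF _ hWoutS, hνF _ hWmidS, mul_add]
    refine add_le_add (lintegral_ratio_le ?_) (lintegral_ratio_le ?_)
    · filter_upwards [hae] with z hz
      exact fibre_stepB S hz hN hρ1
    · filter_upwards [hae] with z hz
      exact fibre_stepB S hz hN hρ1
  -- Step (C): along the horizontal fibres
  have hStepC : ENNReal.ofReal rC * ν P ≤ ν V := by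
    rw [hνF _ hPm, hνF _ hVm, mul_add]
    refine add_le_add (lintegral_ratio_le ?_) (lintegral_ratio_le ?_)
    · filter_upwards [hae] with z hz
      exact fibre_stepC hc hs hcs hz hN hρ2
    · filter_upwards [hae] with z hz
      exact fibre_stepC hc hs hcs hz hN hρ2
  -- containments
  have hOsub : ν O ≤ ν (Wout ×ˢ S) := by
    rw [← hνR _ hWoutS]
    exact measure_mono (farBox_subset hc hs hcs hN)
  have hPeq : ν P = ν (Wmid ×ˢ S) := hνR _ hWmidS
  have hVsub : ν V ≤ ν (A n₀) :=
    measure_mono (innerBox_subset_tail (Nat.cast_nonneg n₀) hρ3)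
  -- the constants
  have hconst : η₀ ≤ rC * (rB * rA) := by
    have h4 : 0 ≤ 4 * ρ ^ 2 - 2 * ρ - 1 - N ^ 2 := by nlinarith
    have e : rC * (rB * rA) - η₀
        = s ^ 3 * c * (4 * ρ ^ 2 - 2 * ρ - 1 - N ^ 2)
            / (20 * Real.pi * N * (2 * N + 1) ^ 2 * (N ^ 2 + (ρ + 1) ^ 2)) := by
      rw [hrC, hrB, hrA, hη₀]
      field_simp
      ring
    have : 0 ≤ rC * (rB * rA) - η₀ := by
      rw [e]
      positivity
    linarith
  -- assemble
  have hchain : η ≤ ν (A n₀) :=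
    calc η = ENNReal.ofReal η₀ * m := rfl
      _ ≤ ENNReal.ofReal (rC * (rB * rA)) * m := by gcongr
      _ = ENNReal.ofReal rC * (ENNReal.ofReal rB * (ENNReal.ofReal rA * m)) := by
          have hrC0 : 0 ≤ rC := by
            rw [hrC]
            exact div_nonneg (by nlinarith [sq_nonneg s]) (by positivity)
          have hrB0 : 0 ≤ rB := by
            rw [hrB]
            have : 0 ≤ c * ρ := by positivity
            exact div_nonneg (by linarith) (by positivity)
          rw [ENNReal.ofReal_mul hrC0, ENNReal.ofReal_mul hrB0]
          ring
      _ ≤ ENNReal.ofReal rC * (ENNReal.ofReal rB * ν O) := by gcongr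
      _ ≤ ENNReal.ofReal rC * (ENNReal.ofReal rB * ν (Wout ×ˢ S)) := by gcongr
      _ ≤ ENNReal.ofReal rC * ν (Wmid ×ˢ S) := by gcongr
      _ = ENNReal.ofReal rC * ν P := by rw [hPeq]
      _ ≤ ν V := hStepC
      _ ≤ ν (A n₀) := hVsub
  exact absurd (lt_of_le_of_lt hchain hn₀) (lt_irrefl _)

/-- **No mass at positive energy.**  Under the frame formula and the rotation invariance of `ν` (with `c, s > 0`,
`c² + s² = 1`): `μ{E > 0} = 0`. -/
theorem measure_pos_energy_eq_zero (μ : Measure (ℝ × ℝ)) [IsFiniteMeasure μ] (hae : ∀ᵐ z ∂μ, 0 ≤ z.1)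
    {c s : ℝ} (hc : 0 < c) (hs : 0 < s) (hcs : c ^ 2 + s ^ 2 = 1)
    (ν : Measure (ℝ × ℝ)) [IsFiniteMeasure ν]
    (hνF : ∀ A : Set (ℝ × ℝ), MeasurableSet A →
        ν A = (∫⁻ z, (volume.withDensity fun x : ℝ => ENNReal.ofReal (Real.pi⁻¹ * (1 + x ^ 2)⁻¹))
                  {x : ℝ | (z.1 * x, z.2) ∈ A} ∂μ)
            + ∫⁻ z, (volume.withDensity fun x : ℝ => ENNReal.ofReal (Real.pi⁻¹ * (1 + x ^ 2)⁻¹))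
                  {x : ℝ | (z.1 * x, -z.2) ∈ A} ∂μ)
    (hνR : ∀ B : Set (ℝ × ℝ), MeasurableSet B →
        ν {q | (c * q.1 + s * q.2, -s * q.1 + c * q.2) ∈ B} = ν B) :
    μ {z | 0 < z.1} = 0 := by
  have hcover : {z : ℝ × ℝ | 0 < z.1}
      ⊆ ⋃ n : ℕ, Icc ((n : ℝ) + 1)⁻¹ ((n : ℝ) + 1) ×ˢ Icc (-((n : ℝ) + 1)) ((n : ℝ) + 1) := by
    intro z hz
    simp only [mem_setOf_eq] at hz
    obtain ⟨n, hn⟩ := exists_nat_ge (max z.1⁻¹ (max z.1 |z.2|))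
    refine mem_iUnion.2 ⟨n, ?_⟩
    have h1 : z.1⁻¹ ≤ n := le_trans (le_max_left _ _) hn
    have h2 : z.1 ≤ n := le_trans (le_trans (le_max_left _ _) (le_max_right _ _)) hn
    have h3 : |z.2| ≤ n := le_trans (le_trans (le_max_right _ _) (le_max_right _ _)) hn
    simp only [mem_prod, mem_Icc]
    refine ⟨⟨?_, by linarith⟩, ?_, ?_⟩
    · rw [inv_le_comm₀ (by positivity) hz]
      linarith
    · linarith [neg_abs_le z.2]
    · linarith [le_abs_self z.2]
  refine measure_mono_null hcover (measure_iUnion_null fun n => ?_)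
  have hN : (1 : ℝ) ≤ (n : ℝ) + 1 := by
    have : (0 : ℝ) ≤ n := Nat.cast_nonneg n
    linarith
  exact measure_box_eq_zero μ hae hc hs hcs ν hνF hνR hN
end Summit.QuantumFields.YangMills.Theorems.F4SubCurvatureDoorTwoMirrorCore

end
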